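import Summits.AtomisticToContinuum.Crystallization.Theorems.ExcessDecayLiouvilleHcpLiouvilleRayIntegral

/-!
# `ExcessDecayLiouville.HcpLiouville` (stmt-AtomisticToContinuum-9332), line `Sketch` v5: box ⇒ secant at anchor `0`

Stub `stub_secantZero_of_box` (composition B of skeleton v5 of the line `Sketch`, crux `HcpLiouville`):
TANGENT box coercivity of the Lennard-Jones second variation at vertex radius `1/40` about EQUILIBRIUM
data (`Adm₀ A`, `Inner₀ t A`, `Equil₀ (Sites₀ t A)`, every displacement `w` with `‖w s‖ ≤ 1/40` on the
sites, every finitely supported test field `φ` on the sites: `κ · nnForm t A φ ≤ ½ · hessFormAt t A w φ`)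
implies ray-secant coercivity `SecantCoercive 0 κ` at anchor radius `0` with the same constant.

Proof.  At anchor radius `0` the anchor shift is `τ = 0`, so `anchorDatum t τ = t` and the shift field
`τ𝟙₁` vanishes: the data of `SecantCoercive 0 κ` are an admissible hcp-like equilibrium datum `(t, A)`,
a field `v` with `‖v s‖ ≤ 1/40` on the sites and a finitely supported test field `φ` on the sites.  For
`θ ∈ [0,1]` the displacement `θ • v` stays in the `1/40`-box and
`hessFormAt t A (θ • v) φ = T(θ) = Σ'Σ' [p ≠ q] Hess₀ ((p − q) + θ(v p − v q)) (φ p − φ q)` termwise, so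
the box inequality gives `κ · nnForm t A φ ≤ T(θ)/2` pointwise on `[0,1]`; `T` is continuous on `[0,1]`
with `∫₀¹ T = secFormAt t A v φ` (`ray_integral_eq_secFormAt`), and integrating the pointwise inequality
(`intervalIntegral.integral_mono_on`) gives `κ · nnForm t A φ ≤ secFormAt t A v φ / 2`.
All `[folklore]`; a `--supports` helper for item stmt-AtomisticToContinuum-9332, nothing here closes an item.
-/

noncomputable section

namespace Summit.AtomisticToContinuum.Crystallization.Theorems.ExcessDecayLiouville

open scoped BigOperators Topology Classical InnerProductSpace
open Literature.MathematicalPhysics.StatisticalMechanics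
open Summit.AtomisticToContinuum.Crystallization.Theses.ExcessDecayLiouville
open Summit.AtomisticToContinuum.Crystallization.Theorems.PhononStabilityNegative

local notation "E3" => EuclideanSpace ℝ (Fin 3)

/-! ## The second variation along the ray -/

/-- Along the ray `θ ↦ s + θ v s` the displaced second variation `hessFormAt t A (θ • v) φ` is, termwise,
the ray integrand `Σ'Σ' [p ≠ q] Hess₀ ((p − q) + θ(v p − v q)) (φ p − φ q)` of
`ray_integral_eq_secFormAt`. [folklore] -/
theorem hessFormAt_ray (t : Fin 2 → E3) (A : E3 →L[ℝ] E3) (v φ : E3 → E3) (θ : ℝ) :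
    hessFormAt t A (fun s => θ • v s) φ =
      ∑' p : Sites₀ t A, ∑' q : Sites₀ t A,
        if (p : E3) ≠ q then Hess₀ ((p : E3) - q + θ • (v p - v q)) (φ p - φ q) else 0 := by
  unfold hessFormAt
  refine tsum_congr fun p => tsum_congr fun q => ?_
  split_ifs
  · congr 1
    rw [smul_sub]
    abel
  · rfl

/-- A displacement scaled by `θ ∈ [0,1]` stays in the `η`-box. [folklore] -/
theorem norm_smul_le_of_mem_Icc {θ η : ℝ} (hθ : θ ∈ Set.Icc (0 : ℝ) 1) {x : E3} (hx : ‖x‖ ≤ η) :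
    ‖θ • x‖ ≤ η := by
  rw [norm_smul, Real.norm_eq_abs, abs_of_nonneg hθ.1]
  nlinarith [hθ.1, hθ.2, norm_nonneg x]

/-! ## The stub -/

/-- **Stub `stub_secantZero_of_box` (line `Sketch` v5, crux `HcpLiouville`)**: tangent box coercivity at
vertex radius `1/40` about equilibrium data implies ray-secant coercivity at anchor radius `0` with the
same constant — the ray `θ ↦ θ • v` stays in the box, the box inequality holds pointwise in `θ ∈ [0,1]`
for the ray integrand (`hessFormAt_ray`), and integrating it (`ray_integral_eq_secFormAt`,
`intervalIntegral.integral_mono_on`) bounds `secFormAt` from below. [folklore] -/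
theorem stub_secantZero_of_box :
    ∀ κ : ℝ,
      (∀ (t : Fin 2 → E3) (A : E3 →L[ℝ] E3), Adm₀ A → Inner₀ t A → Equil₀ (Sites₀ t A) →
        ∀ w : E3 → E3, (∀ s ∈ Sites₀ t A, ‖w s‖ ≤ 1 / 40) →
          ∀ φ : E3 → E3, (Function.support φ).Finite → Function.support φ ⊆ Sites₀ t A →
            κ * nnForm t A φ ≤ hessFormAt t A w φ / 2) →
      SecantCoercive 0 κ := by
  intro κ hbox t A τ hA hI hτ _hIτ hEq v hv φ hφ hφS
  have hτ0 : τ = 0 := norm_le_zero_iff.mp hτ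
  subst hτ0
  simp only [anchorDatum_zero_shift, shiftField_zero, Pi.zero_apply, add_zero] at hEq hv hφS ⊢
  set T : ℝ → ℝ := fun θ => ∑' p : Sites₀ t A, ∑' q : Sites₀ t A,
      if (p : E3) ≠ q then Hess₀ ((p : E3) - q + θ • (v p - v q)) (φ p - φ q) else 0
  have hpt : ∀ θ ∈ Set.Icc (0 : ℝ) 1, κ * nnForm t A φ ≤ T θ / 2 := by
    intro θ hθ
    have h := hbox t A hA hI hEq (fun s => θ • v s)
      (fun s hs => norm_smul_le_of_mem_Icc hθ (hv s hs)) φ hφ hφS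
    rwa [hessFormAt_ray] at h
  have hv' : ∀ s ∈ Sites₀ t A, ‖v s‖ ≤ 3 / 40 := fun s hs => (hv s hs).trans (by norm_num)
  obtain ⟨hcont, hint⟩ := ray_integral_eq_secFormAt t A hA hI v φ hv' hφ
  have hTI : IntervalIntegrable T MeasureTheory.volume 0 1 := by
    refine ContinuousOn.intervalIntegrable ?_
    rw [Set.uIcc_of_le zero_le_one]
    exact hcont
  have hmono := intervalIntegral.integral_mono_on (f := fun _ => κ * nnForm t A φ)
    (g := fun θ => T θ / 2) zero_le_one intervalIntegrable_const (hTI.div_const 2) hpt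
  rw [intervalIntegral.integral_const, sub_zero, one_smul, intervalIntegral.integral_div] at hmono
  have hint' : ∫ θ in (0 : ℝ)..1, T θ = secFormAt t A v φ := hint
  rw [hint'] at hmono
  exact hmono

end Summit.AtomisticToContinuum.Crystallization.Theorems.ExcessDecayLiouville

end
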